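import Mathlib
import Literature.AlgebraicGeometry.Resolution.CobordantGame
import Literature.AlgebraicGeometry.Resolution.CobordantChartCoefficients
import Literature.AlgebraicGeometry.Resolution.CobordantChartPlaneSlice
import Literature.AlgebraicGeometry.Resolution.CobordantTupleGame
import Summits.ResolutionOfSingularities.ResolutionOfSingularities.Theorems.WeightedInvariantLocalWeightedDropWildPurePowerSteps
import Summits.ResolutionOfSingularities.ResolutionOfSingularities.Theorems.WeightedInvariantLocalWeightedDropWildPurePowerShear

/-!
# `WeightedInvariant.LocalWeightedDrop`, line `hasse-ridge-face-selection`: the point-step successor of `y^q + A₀(x₁,x₂)` in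
# coefficients, its order, and the GENERIC BRANCH of the descent (low-multiplicity tangent directions drop the order)

Crux item stmt-ResolutionOfSingularities-8899 `LocalWeightedDrop` (route `ResolutionOfSingularities/WeightedInvariant`),
serving the door `WeightedConstruction` stmt-ResolutionOfSingularities-0571.  [OURS · L1 W4.3, chain w43, stub worker 1
(gen 2): S3πM infrastructure — the first, easy branch of the Hauser–Wagner / Hauser–Perlega descent for `z^{p^e} + F(x,y)`
(after a point blow-up the order drops at every point of the exceptional divisor that is not a root of HIGH multiplicity of the
initial form of `F`).  Not a statement of any manuscript; elementary.]

* `coeff_pointStep_succ₀` / `₁`: the successor coefficient `T = (s · B₀)|` of `WildPurePower.won_purePower_of_pointStep` at the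
  exceptional point `c` (slot `0`, `c₁ ≠ 0`; resp. slot `1`) in terms of the SHEARED coefficient `A₀ ∘ σ_{c₂/c₁}`:
  `[s^r x₂'^j] T = c₁^{r+q-j} · [x₁^{r+q-j} x₂^j] (A₀ ∘ σ)` — the monomial `x₁^a x₂^b` of `A₀ ∘ σ` becomes `s^{a+b-q} x₂'^b`;
* `order_pointStep_succ_le₀` / `₁`: hence `ord T ≤ a + 2b - q` for every monomial `x₁^a x₂^b` of `A₀ ∘ σ`;
* `won_purePower_of_lowMultiplicity`: if for EVERY exceptional direction the sheared coefficient has a monomial `x₁^a x₂^b`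
  with `a + 2b < 2q` (for `ord A₀ = n`: the direction is a root of the initial binary form of multiplicity `< 2q - n`), then
  `y^q + A₀` is won by ONE point blow-up, given the surface germs of order `< q` (every singular successor has order `< q`).
-/

set_option linter.dupNamespace false -- mandated namespace of this single-conjunct summit

namespace Summit.ResolutionOfSingularities.ResolutionOfSingularities.Theorems

open Literature.AlgebraicGeometry.Resolution

namespace WildPurePower

open MvPowerSeries WildTerminal Literature.AlgebraicGeometry.Resolution.CobordantGame

variable {k : Type} [Field k]

/-- Reading a series `T` through `s^q · T`: `[β + q e₁] (s^q T) = [β] T`. -/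
theorem coeff_add_single_X_pow_mul (q : ℕ) (T : MvPowerSeries (Fin 2) k) (β : Fin 2 →₀ ℕ) :
    coeff (β + Finsupp.single 0 q) ((X 0 : MvPowerSeries (Fin 2) k) ^ q * T) = coeff β T := by
  classical
  rw [X_pow_eq, coeff_monomial_mul, if_pos (by intro i; rw [Finsupp.add_apply]; exact le_add_self), one_mul,
    add_tsub_cancel_right]

/-- The sliced transform and the successor coefficient: `(A₀ ∘ chart(c))| = s^q · (s · B₀)|`. -/
theorem slice_subst_pointChart_eq_X_pow_mul {q : ℕ} (i₀ : Fin 2) (c : Fin 2 → k) (A₀ : MvPowerSeries (Fin 2) k)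
    (B₀ : MvPowerSeries (Fin (2 + 1)) k)
    (hB : subst (CobordantChart.chart (fun _ : Fin 2 => 1) c) A₀ = X 0 ^ (q + 1) * B₀) :
    TupleGame.slice i₀ (subst (CobordantChart.chart (fun _ : Fin 2 => 1) c) A₀) =
      (X 0 : MvPowerSeries (Fin 2) k) ^ q * TupleGame.slice i₀ (X 0 * B₀) := by
  rw [hB, pow_succ, mul_assoc, slice_mul, slice_pow, slice_X_zero]

/-- THE POINT-STEP SUCCESSOR IN COEFFICIENTS (slot `0`, `c₁ ≠ 0`): with `σ = (x₁, x₂ + (c₂/c₁) x₁)`,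
`[s^r x₂'^j] (s · B₀)| = c₁^{r+q-j} · [x₁^{r+q-j} x₂^j] (A₀ ∘ σ)` (`0` if `j > r + q`). -/
theorem coeff_pointStep_succ₀ {q : ℕ} (c : Fin 2 → k) (hc : c 0 ≠ 0) (A₀ : MvPowerSeries (Fin 2) k)
    (B₀ : MvPowerSeries (Fin (2 + 1)) k)
    (hB : subst (CobordantChart.chart (fun _ : Fin 2 => 1) c) A₀ = X 0 ^ (q + 1) * B₀) (β : Fin 2 →₀ ℕ) :
    coeff β (TupleGame.slice (0 : Fin 2) (X 0 * B₀)) =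
      if β 1 ≤ β 0 + q then c 0 ^ (β 0 + q - β 1) * coeff (Finsupp.single 0 (β 0 + q - β 1) + Finsupp.single 1 (β 1))
        (subst (fun l : Fin 2 => if l = 0 then (X 0 : MvPowerSeries (Fin 2) k) else X l + C (c 1 / c 0) * X 0) A₀) else 0 := by
  classical
  rw [← coeff_add_single_X_pow_mul q _ β, ← slice_subst_pointChart_eq_X_pow_mul 0 c A₀ B₀ hB,
    slice_subst_pointChart_eq_axis₀ c hc A₀, coeff_slice_subst_pointChart_axis₀ _ (by simp) _ _]
  simp only [Finsupp.add_apply, Finsupp.single_eq_same, Finsupp.single_eq_of_ne (show (1 : Fin 2) ≠ 0 by decide), add_zero,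
    Function.update_of_ne (show (0 : Fin 2) ≠ 1 by decide)]

/-- THE POINT-STEP SUCCESSOR IN COEFFICIENTS (slot `1`, `c₂ ≠ 0`): with `σ' = (x₁ + (c₁/c₂) x₂, x₂)`,
`[s^r x₂'^j] (s · B₀)| = c₂^{r+q-j} · [x₁^j x₂^{r+q-j}] (A₀ ∘ σ')` (`0` if `j > r + q`). -/
theorem coeff_pointStep_succ₁ {q : ℕ} (c : Fin 2 → k) (hc : c 1 ≠ 0) (A₀ : MvPowerSeries (Fin 2) k)
    (B₀ : MvPowerSeries (Fin (2 + 1)) k)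
    (hB : subst (CobordantChart.chart (fun _ : Fin 2 => 1) c) A₀ = X 0 ^ (q + 1) * B₀) (β : Fin 2 →₀ ℕ) :
    coeff β (TupleGame.slice (1 : Fin 2) (X 0 * B₀)) =
      if β 1 ≤ β 0 + q then c 1 ^ (β 0 + q - β 1) * coeff (Finsupp.single 0 (β 1) + Finsupp.single 1 (β 0 + q - β 1))
        (subst (fun l : Fin 2 => if l = 1 then (X 1 : MvPowerSeries (Fin 2) k) else X l + C (c 0 / c 1) * X 1) A₀) else 0 := by
  classical
  rw [← coeff_add_single_X_pow_mul q _ β, ← slice_subst_pointChart_eq_X_pow_mul 1 c A₀ B₀ hB,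
    slice_subst_pointChart_eq_axis₁ c hc A₀, coeff_slice_subst_pointChart_axis₁ _ (by simp) _ _]
  simp only [Finsupp.add_apply, Finsupp.single_eq_same, Finsupp.single_eq_of_ne (show (1 : Fin 2) ≠ 0 by decide), add_zero,
    Function.update_of_ne (show (1 : Fin 2) ≠ 0 by decide)]

/-- ORDER OF THE SUCCESSOR (slot `0`): a monomial `x₁^a x₂^b` of `A₀ ∘ σ` with `a + b ≥ q` bounds `ord (s · B₀)| ≤ a + 2b - q`. -/
theorem order_pointStep_succ_le₀ {q : ℕ} (c : Fin 2 → k) (hc : c 0 ≠ 0) (A₀ : MvPowerSeries (Fin 2) k)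
    (B₀ : MvPowerSeries (Fin (2 + 1)) k)
    (hB : subst (CobordantChart.chart (fun _ : Fin 2 => 1) c) A₀ = X 0 ^ (q + 1) * B₀) {a b : ℕ} (hab : q ≤ a + b)
    (hne : coeff (Finsupp.single 0 a + Finsupp.single 1 b)
      (subst (fun l : Fin 2 => if l = 0 then (X 0 : MvPowerSeries (Fin 2) k) else X l + C (c 1 / c 0) * X 0) A₀) ≠ 0) :
    (TupleGame.slice (0 : Fin 2) (X 0 * B₀)).order ≤ ((a + b - q + b : ℕ) : ℕ∞) := by
  classical
  have h := coeff_pointStep_succ₀ c hc A₀ B₀ hB (Finsupp.single 0 (a + b - q) + Finsupp.single 1 b)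
  simp only [Finsupp.add_apply, Finsupp.single_eq_same, Finsupp.single_eq_of_ne (show (1 : Fin 2) ≠ 0 by decide),
    Finsupp.single_eq_of_ne (show (0 : Fin 2) ≠ 1 by decide), add_zero, zero_add] at h
  rw [if_pos (by omega), show a + b - q + q - b = a by omega] at h
  have hne' : coeff (Finsupp.single 0 (a + b - q) + Finsupp.single 1 b) (TupleGame.slice (0 : Fin 2) (X 0 * B₀)) ≠ 0 := by
    rw [h]; exact mul_ne_zero (pow_ne_zero _ hc) hne
  have hle := order_le hne'
  rwa [map_add, Finsupp.degree_single, Finsupp.degree_single] at hle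

/-- ORDER OF THE SUCCESSOR (slot `1`): a monomial `x₁^b x₂^a` of `A₀ ∘ σ'` with `a + b ≥ q` bounds `ord (s · B₀)| ≤ a + 2b - q`. -/
theorem order_pointStep_succ_le₁ {q : ℕ} (c : Fin 2 → k) (hc : c 1 ≠ 0) (A₀ : MvPowerSeries (Fin 2) k)
    (B₀ : MvPowerSeries (Fin (2 + 1)) k)
    (hB : subst (CobordantChart.chart (fun _ : Fin 2 => 1) c) A₀ = X 0 ^ (q + 1) * B₀) {a b : ℕ} (hab : q ≤ a + b)
    (hne : coeff (Finsupp.single 0 b + Finsupp.single 1 a)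
      (subst (fun l : Fin 2 => if l = 1 then (X 1 : MvPowerSeries (Fin 2) k) else X l + C (c 0 / c 1) * X 1) A₀) ≠ 0) :
    (TupleGame.slice (1 : Fin 2) (X 0 * B₀)).order ≤ ((a + b - q + b : ℕ) : ℕ∞) := by
  classical
  have h := coeff_pointStep_succ₁ c hc A₀ B₀ hB (Finsupp.single 0 (a + b - q) + Finsupp.single 1 b)
  simp only [Finsupp.add_apply, Finsupp.single_eq_same, Finsupp.single_eq_of_ne (show (1 : Fin 2) ≠ 0 by decide),
    Finsupp.single_eq_of_ne (show (0 : Fin 2) ≠ 1 by decide), add_zero, zero_add] at h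
  rw [if_pos (by omega), show a + b - q + q - b = a by omega] at h
  have hne' : coeff (Finsupp.single 0 (a + b - q) + Finsupp.single 1 b) (TupleGame.slice (1 : Fin 2) (X 0 * B₀)) ≠ 0 := by
    rw [h]; exact mul_ne_zero (pow_ne_zero _ hc) hne
  have hle := order_le hne'
  rwa [map_add, Finsupp.degree_single, Finsupp.degree_single] at hle

/-- THE GENERIC BRANCH OF THE DESCENT: `y^q + A₀` (`ord A₀ > q ≥ 1`) IS WON BY ONE POINT BLOW-UP when for every exceptional
direction the sheared coefficient has a monomial `x₁^a x₂^b` (`x₂ =` the direction's complementary variable) with `a + b ≥ q`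
and `a + 2b < 2q` — then every singular successor has order `< q` and is won by the hypothesis on smaller orders.  (For
`ord A₀ = n < 2q` this says: every root of the initial binary form of `A₀` has multiplicity `< 2q - n`; the complementary
HIGH-MULTIPLICITY directions are where the Moh–kangaroo analysis of S3πM lives.) -/
theorem won_purePower_of_lowMultiplicity (p : ℕ) (hp : p.Prime) (k : Type) [Field k] [CharP k p] {q : ℕ} (hq : 0 < q)
    (hord : ∀ g : MvPowerSeries (Fin (2 + 1)) k, CobordantGame.IsSingular k g → g.order < q →
      CobordantGame.Won k (2 + 1) g)
    (A₀ : MvPowerSeries (Fin 2) k) (hA₀ : (q : ℕ∞) < A₀.order)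
    (h₀ : ∀ c : Fin 2 → k, c 0 ≠ 0 → ∃ a b : ℕ, q ≤ a + b ∧ a + 2 * b < 2 * q ∧
      MvPowerSeries.coeff (Finsupp.single 0 a + Finsupp.single 1 b)
        (MvPowerSeries.subst (fun l : Fin 2 => if l = 0 then (MvPowerSeries.X 0 : MvPowerSeries (Fin 2) k)
          else MvPowerSeries.X l + MvPowerSeries.C (c 1 / c 0) * MvPowerSeries.X 0) A₀) ≠ 0)
    (h₁ : ∀ c : Fin 2 → k, c 1 ≠ 0 → ∃ a b : ℕ, q ≤ a + b ∧ a + 2 * b < 2 * q ∧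
      MvPowerSeries.coeff (Finsupp.single 0 b + Finsupp.single 1 a)
        (MvPowerSeries.subst (fun l : Fin 2 => if l = 1 then (MvPowerSeries.X 1 : MvPowerSeries (Fin 2) k)
          else MvPowerSeries.X l + MvPowerSeries.C (c 0 / c 1) * MvPowerSeries.X 1) A₀) ≠ 0) :
    CobordantGame.Won k (2 + 1) (MvPowerSeries.X (Fin.last 2) ^ q +
      MvPowerSeries.rename (Fin.succAboveEmb (Fin.last 2)) A₀) := by
  refine won_purePower_of_pointStep p hp k hq A₀ hA₀ fun c i₀ hci₀ B₀ hB hS => hord _ hS ?_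
  have hi : i₀ = 0 ∨ i₀ = 1 := by fin_cases i₀ <;> simp
  rcases hi with rfl | rfl
  · obtain ⟨a, b, hab, hlt, hne⟩ := h₀ c hci₀
    refine lt_of_le_of_lt (order_X_pow_add_rename_le hq _) (lt_of_le_of_lt (order_pointStep_succ_le₀ c hci₀ A₀ B₀ hB hab hne) ?_)
    exact_mod_cast (by omega : a + b - q + b < q)
  · obtain ⟨a, b, hab, hlt, hne⟩ := h₁ c hci₀
    refine lt_of_le_of_lt (order_X_pow_add_rename_le hq _) (lt_of_le_of_lt (order_pointStep_succ_le₁ c hci₀ A₀ B₀ hB hab hne) ?_)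
    exact_mod_cast (by omega : a + b - q + b < q)

end WildPurePower

end Summit.ResolutionOfSingularities.ResolutionOfSingularities.Theorems
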